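import Summits.Ventures.YMGap.RobustBall.RobustStarDoorZd
import Summits.Ventures.YMGap.RobustBall.RobustStarDoorVariance
import HarnessLib

/-!
# Venture YMGap, track ROBUST-BALL (Y2) — crux Y2-X2-Zd, VARIANCE FORM: the robust vertex-star door ON `ℤ^d` on a one-link
# POINCARÉ × VARIANCE pair (the `N`-uniform route) ⇒ `MassGapOnBallZdG` for every member of the gauge-invariant tier-1 `ℤ^d` ball

HONEST FRAMING. WHAT THIS IS: a venture file (cell `pub-ymgap`, track Y2 ROBUST-BALL, seat ds-2): the `ℤ^d` door of g8
(`RobustStarDoorZd.lean`: chart member on the torus of side `2(R+3)+1`, the torus robust star array pulled back, DLR uniqueness +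
clustering directly in infinite volume) re-run with ds-2 g6's VARIANCE-FORM single-link matrix (`c ≥ e^{ε₀}√(c_P v)|β|/N`,
`λ ≥ e^{ε₀/2}√c_P ε₁` from `OneLinkPoincareSUN N b c_P`, `OneLinkVarianceBound N b v`, `b ≥ 2(d−1)|β|/N`) instead of the Kantorovich
modulus — followed line by line; only the array-construction step (`exists_robustStar_torus_array_variance`) changes. With the all-`N`
Bakry–Émery pair both inputs are free of `N`, so the rows file (`MassGapOnBallZdGRowsSUNStar`) gives `MassGapOnBallZdG d N t ε₀ ε₁ R`
for EVERY `N ≥ 2` from ONE certificate, past the single-link every-`N` threshold. WHAT THIS IS NOT: no number here; strong-coupling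
lattice statements; nothing about the continuum or the Millennium problem.
-/

noncomputable section

open MeasureTheory ProbabilityTheory Function Finset
open Literature.Probability.LatticeModels
open Literature.Probability.LatticeModels.DobrushinMetric
open Literature.MathematicalPhysics.QuantumLattice hiding torusNorm
open Literature.MathematicalPhysics.QuantumFieldTheory hiding ZdEdge
open Literature.MathematicalPhysics.QuantumFieldTheory.Balaban1983to89.StrongCouplingTorusWindow
open Literature.MathematicalPhysics.QuantumFieldTheory.Balaban1983to89.StrongCouplingDobrushinWindow
open Summit.QuantumFields.BalabanUV.InfraRed.StrongCouplingPoincareDoorSUN (OneLinkPoincareSUN)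
open Summit.QuantumFields.BalabanUV.InfraRed.StrongCouplingVarianceDoorSUN (OneLinkVarianceBound)
open Summit.Ventures.YMGap.DSWindow
open Summit.Ventures.YMGap.DSWindowZd
open Summit.Ventures.YMGap.StarKernel
open Summit.Ventures.YMGap.StarResolventDim (Delta gaugeR doorPoly Delta_pos_of_door gaugeR_lt_one_of_door)
open Summit.Ventures.YMGap.StarLemmaGDim
open Summit.Ventures.YMGap.RobustStar

namespace Summit.Ventures.YMGap.RobustBall

variable {d L N : ℕ}

/-! ### The torus data of the robust star door for one member (first half of `clustersWith_of_robustStar`) -/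

/-- **The robust star array of a member of the torus ball of record, VARIANCE FORM** (single-link matrix from a
Poincaré × variance pair, `c ≥ e^{ε₀}√(c_P v)|β|/N`, `λ ≥ e^{ε₀/2}√c_P ε₁` — no `√N`): (H1), (H2) `≤ ρ`, support radius
`max r 1 + 2`. [folklore] -/
theorem exists_robustStar_torus_array_variance [NeZero L] (hd : 2 ≤ d) (hN : 1 ≤ N) (hL : 3 ≤ L)
    {β ε₀ ε₁ b cP v c lam θ ρ : ℝ} {r Kn : ℕ}
    (hcP : 0 ≤ cP) (hv : 0 ≤ v) (hb : |β| / N * (2 * ((d : ℝ) - 1)) ≤ b) (hP : OneLinkPoincareSUN N b cP)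
    (hVB : OneLinkVarianceBound N b v) (hε₁ : 0 ≤ ε₁)
    (hc : Real.exp ε₀ * Real.sqrt (cP * v) * (|β| / N) ≤ c) (hlam : Real.exp (ε₀ / 2) * Real.sqrt cP * ε₁ ≤ lam)
    (hθ : θ = (2 * (d : ℝ) - 2) * c + lam) (hθ1 : θ < 1) (hcd : doorPoly d c < 1)
    (hρ : ρ = gaugeR d c + (lam + θ ^ Kn * (4 * d * lam)) / (1 - θ))
    {W : Perturbation d L N} (hW : W ∈ ClusterDomainFR ε₀ ε₁ r) :
    ∃ Kt : Site d L → Edge d L → Edge d L → ℝ,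
      (∀ s y x, 0 ≤ Kt s y x) ∧
      IsWindowKRContraction (perturbedTorusSpec W β) (id : Edge d L → Edge d L) (linkWeight suFrobDist)
        starWin starWin (fun e => Kt e.1) ∧
      (∀ (s : Site d L) (x : Edge d L), x ∈ vertexStar s → ∑ y, Kt s y x ≤ ρ) ∧
      (∀ (s : Site d L) (y x : Edge d L), Kt s y x ≠ 0 → ∀ w' ∈ linkEnds y, torusNorm (s - w') ≤ max r 1 + 2) := by
  classical
  obtain ⟨hr, w, hwa, hwℓ⟩ := exists_witness_of_mem_clusterDomainFR hW
  have hL1 : 1 < L := by omega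
  have hd1 : 1 ≤ d := by omega
  have hc0 : 0 ≤ c := le_trans (by positivity) hc
  have hlam0 : 0 ≤ lam := le_trans (by positivity) hlam
  have hΔ : 0 < Delta d c := Delta_pos_of_door hd hc0 hcd
  have hgR : 0 ≤ gaugeR d c ∧ gaugeR d c < 1 := gaugeR_lt_one_of_door hd hc0 hcd
  have hd2 : (2 : ℝ) ≤ d := by exact_mod_cast hd
  have hθ0 : 0 ≤ θ := by rw [hθ]; nlinarith
  -- the robust single-link matrix, extended to all links with the off-column array `E`
  set nbr : Edge d L → Finset (Edge d L) := fun e => (univ.erase e).filter fun y => torusNorm (e.1 - y.1) ≤ max r 1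
    with hnbr
  set E : Edge d L → Edge d L → ℝ := fun x z =>
    if z ∈ nbr x then Real.exp (w.oscLoad 0 x / 2) * Real.sqrt cP * w.crossLip 0 x z else 0 with hEdef
  have hE0 : ∀ x z, 0 ≤ E x z := fun x z => by
    simp only [hEdef]; split_ifs
    · exact mul_nonneg (by positivity) (crossLip_nonneg w 0 x z)
    · exact le_rfl
  have hKR := isKRContraction_perturbedTorusSpec_variance_of_hasRange hd1 hN hL1 hcP hv hb hP hVB w hr
  have hcoef : ∀ x : Edge d L, Real.exp (w.oscLoad 0 x) * Real.sqrt (cP * v) * (|β| / N) ≤ c := by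
    intro x
    refine le_trans ?_ hc
    have h1 : Real.exp (w.oscLoad 0 x) ≤ Real.exp ε₀ := Real.exp_le_exp.2 (hwa x)
    gcongr
  have hea2 : ∀ x : Edge d L, Real.exp (w.oscLoad 0 x / 2) ≤ Real.exp (ε₀ / 2) := fun x =>
    Real.exp_le_exp.2 (by linarith [hwa x])
  have hKR' : IsKRContraction (perturbedTorusSpec W β) suFrobDist (fun e => univ.erase e) (Cst c E) := by
    refine isKRContraction_univ_of_le hKR (fun a b => suFrobDist_nonneg a b) (Cst_nonneg hc0 hE0) fun x y hy => ?_
    have hEy : E x y = Real.exp (w.oscLoad 0 x / 2) * Real.sqrt cP * w.crossLip 0 x y := by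
      simp only [hEdef]; exact if_pos hy
    have ht : (0 : ℝ) ≤ tInfluence x y := Nat.cast_nonneg _
    simp only [Cst]
    rw [hEy]
    nlinarith [mul_nonneg (sub_nonneg.2 (hcoef x)) ht]
  have hlamrow : ∀ x, ∑ z ∈ univ.erase x, E x z ≤ lam := by
    intro x
    calc ∑ z ∈ univ.erase x, E x z ≤ ∑ z ∈ univ.erase x, Real.exp (w.oscLoad 0 x / 2) * Real.sqrt cP * w.crossLip 0 x z :=
          sum_le_sum fun z _ => by
            simp only [hEdef]; split_ifs
            · exact le_rfl
            · exact mul_nonneg (by positivity) (crossLip_nonneg w 0 x z)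
      _ = Real.exp (w.oscLoad 0 x / 2) * Real.sqrt cP * w.crossLipLoad 0 x := by rw [← mul_sum]; rfl
      _ ≤ Real.exp (ε₀ / 2) * Real.sqrt cP * ε₁ := by
          refine mul_le_mul (mul_le_mul_of_nonneg_right (hea2 x) (Real.sqrt_nonneg _)) ?_ (crossLipLoad_nonneg w 0 x)
            (by positivity)
          linarith [hwℓ x, selfLipLoad_nonneg w 0 x]
      _ ≤ lam := hlam
  have hrow : ∀ (s : Site d L), ∀ x ∈ vertexStar s, ∑ z ∈ (vertexStar s).erase x, Cst c E x z ≤ θ := by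
    intro s x hx; rw [hθ]; exact sum_star_erase_Cst_le hL hc0 hE0 hlamrow hx
  refine ⟨Krob c E θ Kn, fun s y x => Krob_nonneg hd hc0 hΔ hE0 hθ0 hθ1 Kn s y x,
    robust_star_window (W := W) (β := β) hd hL hc0 hΔ hE0 hθ0 hθ1 hrow hKR' Kn, fun s x hx => ?_, fun s y x hk w' hw' => ?_⟩
  · rw [hρ]; exact sum_Krob_le hd hL hc0 hΔ hgR.2.le hE0 hlamrow hθ0 hθ1 (hrow s) hx
  · have hyw : torusNorm (y.1 - w') ≤ 1 := torusNorm_fst_sub_linkEnds_le_one hw'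
    rcases mem_starBoundary_or_of_Krob_ne_zero hk with hyb | ⟨x', hx', hE'⟩
    · have := torusNorm_le_one_of_mem_starBoundary hyb hw'
      omega
    · have hyn : y ∈ nbr x' := by
        by_contra h
        exact hE' (by simp only [hEdef, if_neg h])
      have hxy : torusNorm (x'.1 - y.1) ≤ max r 1 := (mem_filter.1 hyn).2
      have hsx : torusNorm (s - x'.1) ≤ 1 := torusNorm_sub_fst_le_one_of_mem_vertexStar hx'
      have t1 := torusNorm_sub_le s x'.1 y.1
      have t2 := torusNorm_sub_le s y.1 w'
      omega


/-! ### The star window bound on `ℤ^d` for every member of the gauge-invariant ball, variance form -/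

/-- **THE ROBUST VERTEX-STAR DOOR ON `ℤ^d`, VARIANCE FORM: the star window bound for every member of `MemBallZdG ε₀ ε₁ R`.**
Hypotheses = those of the torus robust star door (`torusClusteringOnBall_of_robustStar`: dimension `d ≥ 2`, a
one-link modulus `OneLinkKRModulus N Rm K` on the radius `Rm ≥ 2(d−1)|β|/N`, the robust coefficient
`K e^{ε₀}(1 + 2√N ε₁)|β|/N ≤ c` below the door `doorPoly d c < 1`, `λ ≥ √N ε₁`, `θ = (2d−2)c + λ < 1`,
`ρ = gaugeR d c + (λ + θ^Kn·4dλ)/(1−θ)`), tree coupling `β`. Conclusion: `StarWindowBoundZdR` for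
`perturbedYM (fundamentalRep (Fin N)) β W supp` with locality radius `max R 1 + 2` and received sum `ρ`.
[folklore] -/
theorem starWindowBoundZdR_of_memBallZdG_variance (hd : 2 ≤ d) (hN : 1 ≤ N) {β ε₀ ε₁ b cP v c lam θ ρ : ℝ}
    {R Kn : ℕ} (hcP : 0 ≤ cP) (hv : 0 ≤ v) (hb : |β| / N * (2 * ((d : ℝ) - 1)) ≤ b) (hP : OneLinkPoincareSUN N b cP)
    (hVB : OneLinkVarianceBound N b v) (hε₁ : 0 ≤ ε₁)
    (hc : Real.exp ε₀ * Real.sqrt (cP * v) * (|β| / N) ≤ c) (hlam : Real.exp (ε₀ / 2) * Real.sqrt cP * ε₁ ≤ lam)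
    (hθ : θ = (2 * (d : ℝ) - 2) * c + lam) (hθ1 : θ < 1) (hcd : doorPoly d c < 1)
    (hρ : ρ = gaugeR d c + (lam + θ ^ Kn * (4 * d * lam)) / (1 - θ))
    {W : Potential (ZdEdge d) (SUN N)} {supp : Finset (ZdEdge d) → Finset (Finset (ZdEdge d))}
    (hW : MemBallZdG ε₀ ε₁ R W supp) :
    StarWindowBoundZdR d N (perturbedYM (d := d) (fundamentalRep (Fin N)) β W supp) (max R 1 + 2) ρ
      suFrobDist := by
  classical
  haveI : SecondCountableTopology (Matrix (Fin N) (Fin N) ℂ) :=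
    inferInstanceAs (SecondCountableTopology (Fin N → Fin N → ℂ))
  haveI : SecondCountableTopology (SUN N) := Topology.IsEmbedding.subtypeVal.secondCountableTopology
  have hd1 : 1 ≤ d := by omega
  -- the torus of side `2(R+3)+1` around each vertex
  set L : ℕ := 2 * (R + 3) + 1 with hLdef
  haveI : NeZero L := ⟨by omega⟩
  have hL3 : 3 ≤ L := by omega
  have hLR3 : 2 * (R + 3) < L := by omega
  have hLR1 : 2 * (R + 1) < L := by omega
  have hDR : max R 1 + 2 ≤ R + 3 := by omega
  -- the active family and the chart member of each star, and its torus array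
  set Sact : (Literature.Probability.LatticeModels.Site d) → Finset (Finset (ZdEdge d)) := fun s =>
    (supp (vertexStarZd s)).filter fun X => (X ∩ vertexStarZd s).Nonempty ∧ W X ≠ 0 with hSact_def
  have hSact : ∀ (s : Literature.Probability.LatticeModels.Site d) X,
      X ∈ Sact s ↔ X ∈ supp (vertexStarZd s) ∧ (X ∩ vertexStarZd s).Nonempty ∧ W X ≠ 0 :=
    fun s X => Finset.mem_filter
  have hmW : ∀ X, Measurable (W X) := fun X => (hW.continuous X).measurable
  have hbW : ∀ X, ∃ C, ∀ U, |W X U| ≤ C := fun X => exists_bound_of_continuous (hW.continuous X)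
  set Wc : (Literature.Probability.LatticeModels.Site d) → Perturbation d L N := fun s =>
    chartMember L (Sact s) W hW.dependsOn hW.gaugeInvariant hmW hbW with hWc
  have hmem : ∀ s, Wc s ∈ ClusterDomainFR ε₀ ε₁ R := fun s => chartMember_star_mem hd1 hW hmW hbW hLR1 s (hSact s)
  choose Kt hKt0 hcontr hsumt hloct using fun s =>
    exists_robustStar_torus_array_variance hd hN hL3 hcP hv hb hP hVB hε₁ hc hlam hθ hθ1 hcd hρ (hmem s)
  -- injectivity of the chart on the big locality set of radius `R + 3`
  have hinj3 : ∀ s : Literature.Probability.LatticeModels.Site d,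
      Set.InjOn (torusEdge L) (starNbhdZdR (R + 3) s : Set (ZdEdge d)) :=
    fun s => injOn_torusEdge_starNbhdZdR hLR3 s
  have hstar3 : ∀ s : Literature.Probability.LatticeModels.Site d, vertexStarZd s ⊆ starNbhdZdR (R + 3) s :=
    fun s => vertexStarZd_subset_starNbhdZdR (by omega) s
  have hD3 : ∀ s : Literature.Probability.LatticeModels.Site d, starNbhdZdR (max R 1 + 2) s ⊆ starNbhdZdR (R + 3) s :=
    fun s => starNbhdZdR_mono hDR s
  refine ⟨fun s y x => if y ∈ starNbhdZdR (max R 1 + 2) s then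
      Kt s (Torus.proj L s) (torusEdge L y) (torusEdge L x) else 0, ?_, ?_, ?_, ?_⟩
  · -- nonnegativity
    intro s y x
    dsimp only
    split_ifs
    · exact hKt0 _ _ _ _
    · exact le_rfl
  · -- support in the locality set
    intro s y x h
    by_contra hy
    exact h (if_neg hy)
  · -- (H1)
    intro c y hyc ω η hωη f δ hfm hfb hfdep hδ0 hδ
    set s : Literature.Probability.LatticeModels.Site d := c.1 with hs
    by_cases hyN : y ∈ starNbhdZdR (max R 1 + 2) s
    swap
    · -- off the locality set: the kernel does not see `y`, the array vanishes
      have heq := perturbed_star_hloc (fundamentalRep (Fin N)) (continuous_fundamentalRep (Fin N)) β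
        (fun X => (hW.continuous X).measurable) hW.dependsOn hW.supportedBy hW.range (le_refl (R + 2)) c ω η
        (fun v hv => hωη v (by rintro rfl; exact hyN (starNbhdZdR_mono (by omega) s hv))) f hfm hfdep
      rw [heq, sub_self, abs_zero]
      refine mul_nonneg (Finset.sum_nonneg fun x _ => mul_nonneg ?_ (hδ0 x)) (suFrobDist_nonneg _ _)
      simp only [if_neg hyN, le_refl]
    -- on the locality set: the window-contraction transfer through the chart member of the star
    have hK : ∀ x, (if y ∈ starNbhdZdR (max R 1 + 2) s then
        Kt s (Torus.proj L s) (torusEdge L y) (torusEdge L x) else 0) =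
        (fun x' => Kt s (Torus.proj L s) (torusEdge L y) x') (torusEdge L x) := fun x => if_pos hyN
    simp_rw [hK]
    have hy3 : y ∈ starNbhdZdR (R + 3) s := hD3 s hyN
    -- injectivity on the transfer set
    have hsub : insert y ((starWinZd c ∪ (starWinZd c).biUnion (perturbedNbr supp)) ∪
        (plaquettesTouching (starWinZd c)).biUnion plaquetteEdges) ⊆ starNbhdZdR (R + 3) s := by
      intro e he
      rcases Finset.mem_insert.1 he with rfl | he
      · exact hy3
      rcases Finset.mem_union.1 he with he | he
      · exact starNbhdZdR_mono (by omega) s (star_collar_subset_starNbhdZdR hW.range (le_refl (R + 2)) s he)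
      · exact starNbhdZdR_mono (by omega) s
          (starNbhdZd_subset_starNbhdZdR (le_refl 2) s (Finset.mem_union_right _ he))
    have hLinj : Set.InjOn (Torus.proj L)
        ((insert y ((starWinZd c ∪ (starWinZd c).biUnion (perturbedNbr supp)) ∪
          (plaquettesTouching (starWinZd c)).biUnion plaquetteEdges)).image Prod.fst :
          Set (Literature.Probability.LatticeModels.Site d)) :=
      (injOn_torusProj_starNbhdZdR hLR3 s).mono (Finset.coe_subset.2 (Finset.image_subset_image hsub))
    -- the projected boundary link is off the torus star
    have hwin : (starWinZd c).image (torusEdge L) = starWin (torusEdge L c) := image_torusEdge_vertexStarZd s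
    have hy' : torusEdge L y ∉ starWin (torusEdge L c) := by
      rw [← hwin]
      intro hmem
      obtain ⟨x, hx, hxy⟩ := Finset.mem_image.1 hmem
      exact hyc ((hinj3 s) (hstar3 s hx) hy3 hxy ▸ hx)
    -- the torus (H1) of the chart member, in the shape of the transfer lemma
    refine perturbed_window_contraction_of_torus (β := β) hW.dependsOn hW.gaugeInvariant hmW hbW
      hW.supportedBy (starWinZd c) (hSact s) hLinj (k' := fun x' => Kt s (Torus.proj L s) (torusEdge L y) x') ?_ hωη
      hfm hfb hfdep hδ0 hδ
    intro V V' hVV' f' δ' hf'm hf'b hf'dep hδ'0 hlip'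
    rw [hwin] at hf'dep ⊢
    exact hcontr s (torusEdge L c) (torusEdge L y) hy' V V' (fun v hv => hVV' v hv) f' δ' hf'm hf'b hf'dep hδ'0
      fun x U U' hUU' => hlip' x U U' fun e' he' => hUU' e' he'
  · -- (H2)
    intro s x hx
    have hx' : torusEdge L x ∈ vertexStar (Torus.proj L s) := torusEdge_mem_vertexStar_proj hx
    have hinjD : Set.InjOn (torusEdge L) (starNbhdZdR (max R 1 + 2) s : Set (ZdEdge d)) :=
      (hinj3 s).mono (Finset.coe_subset.2 (hD3 s))
    have h1 : ∑ y ∈ starNbhdZdR (max R 1 + 2) s, (if y ∈ starNbhdZdR (max R 1 + 2) s then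
          Kt s (Torus.proj L s) (torusEdge L y) (torusEdge L x) else 0) =
        ∑ y ∈ starNbhdZdR (max R 1 + 2) s, Kt s (Torus.proj L s) (torusEdge L y) (torusEdge L x) :=
      Finset.sum_congr rfl fun y hy => if_pos hy
    have h2 : ∑ y ∈ (starNbhdZdR (max R 1 + 2) s).image (torusEdge L), Kt s (Torus.proj L s) y (torusEdge L x) =
        ∑ y ∈ starNbhdZdR (max R 1 + 2) s, Kt s (Torus.proj L s) (torusEdge L y) (torusEdge L x) :=
      Finset.sum_image fun a ha b hb h => hinjD ha hb h
    have h3 : ∑ y ∈ (starNbhdZdR (max R 1 + 2) s).image (torusEdge L), Kt s (Torus.proj L s) y (torusEdge L x) ≤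
        ∑ y, Kt s (Torus.proj L s) y (torusEdge L x) :=
      Finset.sum_le_sum_of_subset_of_nonneg (Finset.subset_univ _) fun y _ _ => hKt0 _ _ _ _
    rw [h1, ← h2]
    exact h3.trans (hsumt s _ _ hx')

/-! ### The mass gap on the gauge-invariant `ℤ^d` ball, variance form -/

/-- **THE MASS GAP, UNIFORMLY ON THE GAUGE-INVARIANT TIER-1 `ℤ^d` BALL, THROUGH THE ROBUST STAR DOOR, VARIANCE FORM.** Under
the hypotheses of `starWindowBoundZdR_of_memBallZdG` at tree coupling `N β` ('t Hooft `β`) and `ρ < 1`: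
`MassGapOnBallZdG d N β ε₀ ε₁ R` — every member has exactly one DLR state and Shen–Zhu–Zhu exponential
clustering of Lipschitz cylinder observables (`perturbedMassGapAt_of_starWindowBoundZdR`, infinite volume
throughout). [folklore] -/
theorem massGapOnBallZdG_of_robustStar_variance (hd : 2 ≤ d) (hN : 1 ≤ N) {β ε₀ ε₁ b cP v c lam θ ρ : ℝ} {R Kn : ℕ}
    (hcP : 0 ≤ cP) (hv : 0 ≤ v) (hb : |(N : ℝ) * β| / N * (2 * ((d : ℝ) - 1)) ≤ b) (hP : OneLinkPoincareSUN N b cP)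
    (hVB : OneLinkVarianceBound N b v) (hε₁ : 0 ≤ ε₁) (hc : Real.exp ε₀ * Real.sqrt (cP * v) * (|(N : ℝ) * β| / N) ≤ c)
    (hlam : Real.exp (ε₀ / 2) * Real.sqrt cP * ε₁ ≤ lam) (hθ : θ = (2 * (d : ℝ) - 2) * c + lam) (hθ1 : θ < 1)
    (hcd : doorPoly d c < 1) (hρ : ρ = gaugeR d c + (lam + θ ^ Kn * (4 * d * lam)) / (1 - θ)) (hρ1 : ρ < 1) :
    MassGapOnBallZdG d N β ε₀ ε₁ R := by
  intro W supp hW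
  have hc0 : 0 ≤ c := le_trans (by positivity) hc
  have hlam0 : 0 ≤ lam := le_trans (by positivity) hlam
  have hgR : 0 ≤ gaugeR d c ∧ gaugeR d c < 1 := gaugeR_lt_one_of_door hd hc0 hcd
  have hd2 : (2 : ℝ) ≤ d := by exact_mod_cast hd
  have hθ0 : 0 ≤ θ := by rw [hθ]; nlinarith
  have h1θ : 0 < 1 - θ := by linarith
  have hρ0 : 0 ≤ ρ := by
    rw [hρ]
    refine add_nonneg hgR.1 (div_nonneg (add_nonneg hlam0 ?_) h1θ.le)
    have : 0 ≤ θ ^ Kn := pow_nonneg hθ0 Kn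
    positivity
  exact perturbedMassGapAt_of_starWindowBoundZdR hW.continuous hW.dependsOn hW.supportedBy hW.range
    (by omega) hρ0 hρ1 (starWindowBoundZdR_of_memBallZdG_variance hd hN hcP hv hb hP hVB hε₁ hc hlam hθ hθ1 hcd hρ hW)

end Summit.Ventures.YMGap.RobustBall

end
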